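import Summits.NavierStokesRegularity.NavierStokesRegularity.Theorems.StrainDoorsUlocGronwallSupTypeI
import Literature.Analysis.FluidPDE.SereginSverakLocalEnergy
import Literature.Analysis.FluidPDE.WholeSpaceIBP
import Literature.Analysis.FluidPDE.LerayHopfSpatialGradient
import HarnessLib

/-!
# Strain doors, PART M §M31(a)–(b) — the window cut-off and the slice tools for LINK 2

ROUND 70 of the `ns-regularity-ideate` programme (p1 line; helper lane of `stmt-NavierStokesRegularity-0056`,
rung N0; nothing here is a claim about Navier–Stokes regularity).  ROUND 69 proved door X′ (the `L²`-Morrey Type-I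
bound from the sup-norm rate IN THE ENERGY CLASS, constant `M₂(M, ‖u₀‖₂, T₀)`) and typed door X″
`UlocMorreyBoundSupTypeI`: the same bound with an `M`-ONLY constant at all radii `r² < T`.  ROUND 70 CLOSES X″ by a
uniformly-local energy Grönwall argument under the rate, in three links, ALL PROVED: LINK 1 (the pressure pairing of
the local energy inequality is LINEAR in the local energies under a sup bound, `M`-free constants — texts N11a/N11b),
LINK 2 (the sliced local energy inequality under the rate at unit scale is linear with `M`-only data — typed in N11c,
PROVED in N11e/N11f/N11g), LINK 3 (LINK 2 ⇒ X″ by Grönwall and Leray rescaling — N11c); N11d puts them together: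
`ulocMorreyBoundSupTypeI_holds : UlocMorreyBoundSupTypeI`.

THIS FILE (imports N11c; tree otherwise):
* §M31(a) the window cut-off `winCutoffAt T y s x = η(s − T) χ(x − y)` built from Mathlib `ContDiffBump`s
  (`η`: `rIn = 1/2`, `rOut = 1` on `ℝ`; `χ`: `rIn = 1`, `rOut = 2` on `ℝ³`): a space-time test function
  (`isSpaceTimeTestOn_winCutoffAt`), `0 ≤ ζ ≤ 1`, `ζ = 1` on `[T − 1/2, T + 1/2] × B̄(y,1)`, `ζ ≠ 0` only on
  `(T − 1, T + 1) × B(y,2)`, ONE bound `M_ζ` for `|∂ₛζ|, |Δζ|, |∇ζ|` uniformly in `(T, y)` (translation invariance,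
  `exists_winCutoff_deriv_bound`, `winCutoffAt_deriv_bound`), and the vanishing of all weights off the window
  (`winCutoffAt_weights_eq_zero`);
* §M31(b) slice tools: the AVERAGING LEMMA `setLIntegral_ball_le_mul_iSup` — `∫⁻_{B(y,R)} f ≤ (R+1)³ sup_z ∫⁻_{B(z,1)} f`
  (Tonelli over the unit balls centred in `B(y,R+1)`; replaces a lattice covering), its `ulocEnergy` form, the `L³ᐟ²`
  slice `memLp_normSq_threeHalves_of_bound` (`|w|² ∈ L^{3/2}` for `w ∈ L² ∩ L^∞`), the orthogonality
  `integral_inner_gradient_eq_zero_of_isDivFree` (`∫ ⟪v, ∇θ⟫ = 0` for `div v = 0`, `θ ∈ C¹_c`, tree `WholeSpaceIBP`),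
  and the continuity of `t ↦ ∫_{B̄(y,1)} |u(t)|²` for jointly continuous `u` (`continuousOn_ballEnergy`).
Four definitions (`winTimeProfile`, `winSpaceProfile`, `winCutoff`, `winCutoffAt`) ⇒ S-lane `--kind definition`.
No `sorry`, no new axioms, no instances, no notation.
-/

noncomputable section

set_option linter.dupNamespace false

open MeasureTheory Set Function Filter Metric Real
open _root_.Topology
open scoped ENNReal NNReal RealInnerProductSpace Laplacian
open Literature.Analysis Literature.Analysis.FluidPDE

namespace Summit.NavierStokesRegularity.NavierStokesRegularity.Theorems.StrainDoors

/-! ### §M31(a) The window cut-off `ζ_{T,y}(s,x) = η(s − T) χ(x − y)` -/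

/-- Time profile of the window cut-off: a smooth bump on `ℝ`, `= 1` on `[-1/2, 1/2]`, supported in
`(-1, 1)`. [folklore] -/
def winTimeProfile : ContDiffBump (0 : ℝ) := ⟨1 / 2, 1, by norm_num, by norm_num⟩

/-- Space profile of the window cut-off: a smooth bump on `ℝ³`, `= 1` on `B̄(0, 1)`, supported in
`B(0, 2)`. [folklore] -/
def winSpaceProfile : ContDiffBump (0 : EuclideanSpace ℝ (Fin 3)) := ⟨1, 2, by norm_num, by norm_num⟩

/-- The unit window cut-off `Z(s, x) = η(s) χ(x)`. [folklore] -/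
def winCutoff (s : ℝ) (x : EuclideanSpace ℝ (Fin 3)) : ℝ :=
  (winTimeProfile : ℝ → ℝ) s * (winSpaceProfile : EuclideanSpace ℝ (Fin 3) → ℝ) x

/-- The window cut-off at `(T, y)`: `ζ(s, x) = Z(s − T, x − y)` (a translate, realised as `stPull`).
[folklore] -/
def winCutoffAt (T : ℝ) (y : EuclideanSpace ℝ (Fin 3)) : ℝ → EuclideanSpace ℝ (Fin 3) → ℝ :=
  stPull 1 1 (-T) (-y) winCutoff

/-- `0 ≤ Z ≤ 1`. [folklore] -/
theorem winCutoff_nonneg_le_one (s : ℝ) (x : EuclideanSpace ℝ (Fin 3)) :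
    0 ≤ winCutoff s x ∧ winCutoff s x ≤ 1 :=
  ⟨mul_nonneg winTimeProfile.nonneg winSpaceProfile.nonneg,
    mul_le_one₀ winTimeProfile.le_one winSpaceProfile.nonneg winSpaceProfile.le_one⟩

/-- `Z = 1` on `[-1/2, 1/2] × B̄(0, 1)`. [folklore] -/
theorem winCutoff_eq_one {s : ℝ} {x : EuclideanSpace ℝ (Fin 3)} (hs : s ∈ Icc (-1 / 2 : ℝ) (1 / 2))
    (hx : ‖x‖ ≤ 1) : winCutoff s x = 1 := by
  rw [winCutoff, winTimeProfile.one_of_mem_closedBall, winSpaceProfile.one_of_mem_closedBall, one_mul]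
  · simpa [winSpaceProfile] using hx
  · rw [mem_closedBall, Real.dist_eq, sub_zero, abs_le]
    simp only [winTimeProfile]
    exact ⟨by linarith [hs.1], hs.2⟩

/-- Off `(-1, 1) × B(0, 2)` the unit window cut-off vanishes (contrapositive). [folklore] -/
theorem winCutoff_ne_zero {s : ℝ} {x : EuclideanSpace ℝ (Fin 3)} (h : winCutoff s x ≠ 0) :
    s ∈ Ioo (-1 : ℝ) 1 ∧ ‖x‖ < 2 := by
  obtain ⟨h1, h2⟩ := mul_ne_zero_iff.1 h
  have h1' : s ∈ Function.support (winTimeProfile : ℝ → ℝ) := h1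
  have h2' : x ∈ Function.support (winSpaceProfile : EuclideanSpace ℝ (Fin 3) → ℝ) := h2
  rw [ContDiffBump.support_eq, mem_ball, Real.dist_eq, sub_zero] at h1'
  rw [ContDiffBump.support_eq, mem_ball, dist_zero_right] at h2'
  refine ⟨?_, by simpa [winSpaceProfile] using h2'⟩
  simp only [winTimeProfile] at h1'
  rw [abs_lt] at h1'
  exact ⟨h1'.1, h1'.2⟩

/-- The unit window cut-off is a space–time test function on `ℝ × ℝ³`. [folklore] -/
theorem isSpaceTimeTestOn_winCutoff :
    IsSpaceTimeTestOn (⊤ : TopologicalSpace.Opens (ℝ × EuclideanSpace ℝ (Fin 3))) winCutoff := by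
  refine ⟨(winTimeProfile.contDiff.comp contDiff_fst).mul (winSpaceProfile.contDiff.comp contDiff_snd),
    ?_, fun _ _ => trivial⟩
  refine HasCompactSupport.intro ((isCompact_Icc (a := (-1 : ℝ)) (b := 1)).prod
    (isCompact_closedBall (0 : EuclideanSpace ℝ (Fin 3)) 2)) fun z hz => ?_
  by_contra h
  obtain ⟨h1, h2⟩ := winCutoff_ne_zero h
  exact hz ⟨⟨h1.1.le, h1.2.le⟩, mem_closedBall_zero_iff.2 h2.le⟩

/-- Sup bounds for the derivatives of the unit window cut-off: `|∂ₛZ|, |ΔZ|, ‖∇Z‖ ≤ M_Z` for one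
constant `M_Z ≥ 0`. [folklore] -/
theorem exists_winCutoff_deriv_bound : ∃ Mz : ℝ, 0 ≤ Mz ∧
    (∀ s x, |timeDeriv winCutoff s x| ≤ Mz) ∧ (∀ s x, |(Δ (winCutoff s)) x| ≤ Mz) ∧
    (∀ s x, ‖gradient (winCutoff s) x‖ ≤ Mz) := by
  have hζ := isSpaceTimeTestOn_winCutoff
  have hKc : IsCompact (tsupport (uncurry winCutoff)) := hζ.hasCompactSupport
  have hw0 : ∀ z ∉ tsupport (uncurry winCutoff), winCutoff z.1 z.2 = 0 ∧
      gradient (winCutoff z.1) z.2 = 0 ∧ (Δ (winCutoff z.1)) z.2 = 0 ∧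
      timeDeriv winCutoff z.1 z.2 = 0 := fun z hz => weights_eq_zero_of_notMem_tsupport hz
  have hc_t : Continuous fun z : ℝ × EuclideanSpace ℝ (Fin 3) => timeDeriv winCutoff z.1 z.2 :=
    hζ.continuous_timeDeriv
  have hc_l : Continuous fun z : ℝ × EuclideanSpace ℝ (Fin 3) => (Δ (winCutoff z.1)) z.2 := by
    have h := ((hζ.isSmoothSpaceTimeOn univ).laplacian uniqueDiffOn_univ).continuousOn
    rw [univ_prod_univ, continuousOn_univ] at h
    exact h
  have hc_g : Continuous fun z : ℝ × EuclideanSpace ℝ (Fin 3) => gradient (winCutoff z.1) z.2 := by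
    have h := ((hζ.isSmoothSpaceTimeOn univ).gradient uniqueDiffOn_univ).continuousOn
    rw [univ_prod_univ, continuousOn_univ] at h
    exact h
  obtain ⟨Mt, hMt⟩ := hc_t.bounded_above_of_compact_support
    (HasCompactSupport.intro hKc fun z hz => (hw0 z hz).2.2.2)
  obtain ⟨Ml, hMl⟩ := hc_l.bounded_above_of_compact_support
    (HasCompactSupport.intro hKc fun z hz => (hw0 z hz).2.2.1)
  obtain ⟨Mg, hMg⟩ := hc_g.bounded_above_of_compact_support
    (HasCompactSupport.intro hKc fun z hz => (hw0 z hz).2.1)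
  refine ⟨max (max Mt Ml) (max Mg 0), le_max_of_le_right (le_max_right _ _),
    fun s y => ?_, fun s y => ?_, fun s y => ?_⟩
  · exact ((Real.norm_eq_abs _).symm.le.trans (hMt (s, y))).trans
      (le_max_of_le_left (le_max_left _ _))
  · exact ((Real.norm_eq_abs _).symm.le.trans (hMl (s, y))).trans
      (le_max_of_le_left (le_max_right _ _))
  · exact (hMg (s, y)).trans (le_max_of_le_right (le_max_left _ _))

/-- Unfolding the window cut-off at `(T, y)`. [folklore] -/
theorem winCutoffAt_apply (T : ℝ) (y : EuclideanSpace ℝ (Fin 3)) (s : ℝ) (x : EuclideanSpace ℝ (Fin 3)) :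
    winCutoffAt T y s x = winCutoff (s - T) (x - y) := by
  simp only [winCutoffAt, stPull_apply, one_mul, one_smul]
  congr 1
  · ring
  · abel

/-- `0 ≤ ζ ≤ 1` for the window cut-off at `(T, y)`. [folklore] -/
theorem winCutoffAt_nonneg_le_one (T : ℝ) (y : EuclideanSpace ℝ (Fin 3)) (s : ℝ)
    (x : EuclideanSpace ℝ (Fin 3)) : 0 ≤ winCutoffAt T y s x ∧ winCutoffAt T y s x ≤ 1 := by
  rw [winCutoffAt_apply]; exact winCutoff_nonneg_le_one _ _

/-- The window cut-off at `(T, y)` is a space–time test function on `ℝ × ℝ³`. [folklore] -/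
theorem isSpaceTimeTestOn_winCutoffAt (T : ℝ) (y : EuclideanSpace ℝ (Fin 3)) :
    IsSpaceTimeTestOn (⊤ : TopologicalSpace.Opens (ℝ × EuclideanSpace ℝ (Fin 3))) (winCutoffAt T y) :=
  (isSpaceTimeTestOn_winCutoff.stPull one_ne_zero one_ne_zero _ _).mono le_top

/-- Where the window cut-off at `(T, y)` does not vanish: `T − 1 < s < T + 1`, `‖x − y‖ < 2`.
[folklore] -/
theorem winCutoffAt_ne_zero {T : ℝ} {y : EuclideanSpace ℝ (Fin 3)} {s : ℝ} {x : EuclideanSpace ℝ (Fin 3)}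
    (h : winCutoffAt T y s x ≠ 0) : s ∈ Ioo (T - 1) (T + 1) ∧ ‖x - y‖ < 2 := by
  rw [winCutoffAt_apply] at h
  obtain ⟨h1, h2⟩ := winCutoff_ne_zero h
  exact ⟨⟨by linarith [h1.1], by linarith [h1.2]⟩, h2⟩

/-- The support of the window cut-off at `(T, y)` lies in `{s ≥ T − 1} × B̄(y, 2)`. [folklore] -/
theorem tsupport_winCutoffAt_subset (T : ℝ) (y : EuclideanSpace ℝ (Fin 3)) :
    tsupport (uncurry (winCutoffAt T y)) ⊆
      {z : ℝ × EuclideanSpace ℝ (Fin 3) | T - 1 ≤ z.1 ∧ ‖z.2 - y‖ ≤ 2} := by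
  refine closure_minimal (fun z hz => ?_) ?_
  · have h := winCutoffAt_ne_zero (T := T) (y := y) (s := z.1) (x := z.2) hz
    exact ⟨h.1.1.le, h.2.le⟩
  · exact (isClosed_le continuous_const continuous_fst).inter
      (isClosed_le (continuous_norm.comp (continuous_snd.sub continuous_const)) continuous_const)

/-- `ζ = 1` on `[T − 1/2, T + 1/2] × B̄(y, 1)`. [folklore] -/
theorem winCutoffAt_eq_one {T : ℝ} {y : EuclideanSpace ℝ (Fin 3)} {s : ℝ} {x : EuclideanSpace ℝ (Fin 3)}
    (hs : s ∈ Icc (T - 1 / 2) (T + 1 / 2)) (hx : ‖x - y‖ ≤ 1) : winCutoffAt T y s x = 1 := by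
  rw [winCutoffAt_apply]
  exact winCutoff_eq_one ⟨by linarith [hs.1], by linarith [hs.2]⟩ hx

/-- Derivative bounds for the window cut-off at `(T, y)` (translation invariance: the constant of
`exists_winCutoff_deriv_bound`). [folklore] -/
theorem winCutoffAt_deriv_bound {Mz : ℝ} (hM : (∀ s x, |timeDeriv winCutoff s x| ≤ Mz) ∧
    (∀ s x, |(Δ (winCutoff s)) x| ≤ Mz) ∧ (∀ s x, ‖gradient (winCutoff s) x‖ ≤ Mz))
    (T : ℝ) (y : EuclideanSpace ℝ (Fin 3)) (s : ℝ) (x : EuclideanSpace ℝ (Fin 3)) :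
    |timeDeriv (winCutoffAt T y) s x| ≤ Mz ∧ |(Δ (winCutoffAt T y s)) x| ≤ Mz ∧
      ‖gradient (winCutoffAt T y s) x‖ ≤ Mz := by
  refine ⟨?_, ?_, ?_⟩
  · rw [winCutoffAt, timeDeriv_stPull, one_smul]
    exact hM.1 _ _
  · rw [winCutoffAt, laplacian_stPull _ _ _ _ _ _ _ (isSpaceTimeTestOn_winCutoff.contDiff_slice_two _),
      one_pow, one_smul]
    exact hM.2.1 _ _
  · rw [winCutoffAt, gradient_stPull, one_smul]
    exact hM.2.2 _ _

/-- The weights of the local energy inequality vanish off the support of the cut-off; in particular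
`∇ζ(s, ·) = 0` off `B(y, 2)` and all weights vanish for `s ≤ T − 1`... (strict: `s < T − 1`).
[folklore] -/
theorem winCutoffAt_weights_eq_zero {T : ℝ} {y : EuclideanSpace ℝ (Fin 3)} {s : ℝ}
    {x : EuclideanSpace ℝ (Fin 3)} (h : s < T - 1 ∨ 2 < ‖x - y‖) :
    winCutoffAt T y s x = 0 ∧ gradient (winCutoffAt T y s) x = 0 ∧ (Δ (winCutoffAt T y s)) x = 0 ∧
      timeDeriv (winCutoffAt T y) s x = 0 := by
  refine weights_eq_zero_of_notMem_tsupport (φ := winCutoffAt T y) (z := (s, x)) fun hz => ?_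
  have h' := tsupport_winCutoffAt_subset T y hz
  rcases h with h | h
  · exact absurd h'.1 (not_le.2 h)
  · exact absurd h'.2 (not_le.2 h)

/-! ### §M31(b) Slice tools: averaging over unit balls, the `L³` slice, orthogonality, continuity -/

/-- **Averaging over unit balls**: `∫_{B(y,R)} f ≤ (R + 1)³ · sup_z ∫_{B(z,1)} f` on `ℝ³`
(`|B(x,1)| f(x) = ∫_z 1_{|z−x|<1} f(x)`, Tonelli, and `B(y,R) ∩ B(z,1) = ∅` unless `z ∈ B(y, R+1)`).
[folklore] -/
theorem setLIntegral_ball_le_mul_iSup {f : EuclideanSpace ℝ (Fin 3) → ℝ≥0∞} (hf : AEMeasurable f volume)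
    (y : EuclideanSpace ℝ (Fin 3)) {R : ℝ} (hR : 0 < R) :
    ∫⁻ x in ball y R, f x ≤
      ENNReal.ofReal ((R + 1) ^ 3) * ⨆ z : EuclideanSpace ℝ (Fin 3), ∫⁻ x in ball z 1, f x := by
  set S : ℝ≥0∞ := ⨆ z : EuclideanSpace ℝ (Fin 3), ∫⁻ x in ball z 1, f x with hS
  set V₁ : ℝ≥0∞ := volume (ball (0 : EuclideanSpace ℝ (Fin 3)) 1) with hV₁
  have hV0 : V₁ ≠ 0 := (measure_ball_pos volume _ one_pos).ne'
  have hVt : V₁ ≠ ⊤ := measure_ball_lt_top.ne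
  -- `V₁ ∫_{B(y,R)} f = ∫_{x ∈ B(y,R)} ∫_z 1_{B(x,1)}(z) f(x)`
  have h1 : V₁ * ∫⁻ x in ball y R, f x =
      ∫⁻ x in ball y R, ∫⁻ z, (ball x 1).indicator (fun _ => f x) z := by
    rw [← lintegral_const_mul'' _ hf.restrict]
    refine lintegral_congr fun x => ?_
    rw [lintegral_indicator measurableSet_ball, setLIntegral_const, Measure.addHaar_ball_center, mul_comm]
  -- Tonelli
  have hmeas : AEMeasurable (uncurry fun (x z : EuclideanSpace ℝ (Fin 3)) =>
      (ball x 1).indicator (fun _ => f x) z) ((volume.restrict (ball y R)).prod volume) := by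
    have e : uncurry (fun (x z : EuclideanSpace ℝ (Fin 3)) => (ball x 1).indicator (fun _ => f x) z) =
        {q : EuclideanSpace ℝ (Fin 3) × EuclideanSpace ℝ (Fin 3) | dist q.2 q.1 < 1}.indicator
          (fun q => f q.1) := by
      funext q
      simp only [uncurry, indicator, mem_ball, mem_setOf_eq]
    rw [e]
    refine AEMeasurable.indicator ?_
      (isOpen_lt (continuous_snd.dist continuous_fst) continuous_const).measurableSet
    exact hf.restrict.comp_quasiMeasurePreserving Measure.quasiMeasurePreserving_fst
  have h2 := lintegral_lintegral_swap hmeas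
  -- the inner integrals after the swap
  have h3 : ∀ z : EuclideanSpace ℝ (Fin 3),
      ∫⁻ x in ball y R, (ball x 1).indicator (fun _ => f x) z ≤ (ball y (R + 1)).indicator (fun _ => S) z := by
    intro z
    by_cases hz : z ∈ ball y (R + 1)
    · rw [indicator_of_mem hz]
      calc ∫⁻ x in ball y R, (ball x 1).indicator (fun _ => f x) z
          ≤ ∫⁻ x in ball y R, (ball z 1).indicator f x :=
            lintegral_mono fun x => by
              by_cases hx : z ∈ ball x 1
              · rw [indicator_of_mem hx, indicator_of_mem (mem_ball_comm.1 hx)]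
              · rw [indicator_of_notMem hx]; exact bot_le
        _ ≤ ∫⁻ x, (ball z 1).indicator f x := setLIntegral_le_lintegral _ _
        _ = ∫⁻ x in ball z 1, f x := lintegral_indicator measurableSet_ball _
        _ ≤ S := le_iSup (fun z : EuclideanSpace ℝ (Fin 3) => ∫⁻ x in ball z 1, f x) z
    · rw [indicator_of_notMem hz]
      refine le_of_eq ((setLIntegral_congr_fun measurableSet_ball fun x hx => ?_).trans lintegral_zero)
      refine indicator_of_notMem (fun hzx => hz ?_) _
      rw [mem_ball] at hx hzx ⊢
      linarith [dist_triangle z x y]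
  -- assemble
  have h4 : V₁ * ∫⁻ x in ball y R, f x ≤ V₁ * (ENNReal.ofReal ((R + 1) ^ 3) * S) := by
    rw [h1]
    calc ∫⁻ x in ball y R, ∫⁻ z, (ball x 1).indicator (fun _ => f x) z
        = ∫⁻ z, ∫⁻ x in ball y R, (ball x 1).indicator (fun _ => f x) z := h2
      _ ≤ ∫⁻ z, (ball y (R + 1)).indicator (fun _ => S) z := lintegral_mono h3
      _ = S * volume (ball y (R + 1)) := by
          rw [lintegral_indicator measurableSet_ball, setLIntegral_const]
      _ = V₁ * (ENNReal.ofReal ((R + 1) ^ 3) * S) := by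
          rw [Measure.addHaar_ball volume y (by linarith : (0 : ℝ) ≤ R + 1), finrank_euclideanSpace_fin,
            ENNReal.ofReal_pow (by linarith)]
          ring
  calc ∫⁻ x in ball y R, f x = V₁⁻¹ * (V₁ * ∫⁻ x in ball y R, f x) := by
        rw [← mul_assoc, ENNReal.inv_mul_cancel hV0 hVt, one_mul]
    _ ≤ V₁⁻¹ * (V₁ * (ENNReal.ofReal ((R + 1) ^ 3) * S)) := mul_le_mul' le_rfl h4
    _ = ENNReal.ofReal ((R + 1) ^ 3) * S := by
        rw [← mul_assoc, ENNReal.inv_mul_cancel hV0 hVt, one_mul]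

/-- Uniformly local energies dominate ball energies: `∫⁻_{B(y,R)} ‖w‖ₑ² ≤ (R+1)³ · ulocEnergy w`.
[folklore] -/
theorem setLIntegral_ball_le_mul_ulocEnergy {w : EuclideanSpace ℝ (Fin 3) → EuclideanSpace ℝ (Fin 3)}
    (hw : AEStronglyMeasurable w volume) (y : EuclideanSpace ℝ (Fin 3)) {R : ℝ} (hR : 0 < R) :
    ∫⁻ x in ball y R, ‖w x‖ₑ ^ 2 ≤ ENNReal.ofReal ((R + 1) ^ 3) * ulocEnergy w :=
  setLIntegral_ball_le_mul_iSup (hw.enorm.pow_const 2) y hR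

/-- **The `L³` slice**: a bounded `L²` field has `|w|² ∈ L^{3/2}`. [folklore] -/
theorem memLp_normSq_threeHalves_of_bound {w : EuclideanSpace ℝ (Fin 3) → EuclideanSpace ℝ (Fin 3)}
    {K : ℝ} (h2 : MemLp w 2 volume) (hK : ∀ x, ‖w x‖ ≤ K) :
    MemLp (fun x => ‖w x‖ ^ 2) (3 / 2 : ℝ≥0∞) volume := by
  have hw : AEStronglyMeasurable w volume := h2.1
  have hK0 : 0 ≤ K := (norm_nonneg _).trans (hK 0)
  have h3 : MemLp w 3 volume := by
    refine ⟨hw, ?_⟩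
    rw [eLpNorm_lt_top_iff_lintegral_rpow_enorm_lt_top (by norm_num) (by norm_num)]
    have h2' := h2.2
    rw [eLpNorm_lt_top_iff_lintegral_rpow_enorm_lt_top (by norm_num) (by norm_num)] at h2'
    have e2 : ∀ x, ‖w x‖ₑ ^ ((2 : ℝ≥0∞).toReal) = ‖w x‖ₑ ^ (2 : ℕ) := fun x => by
      rw [show (2 : ℝ≥0∞).toReal = ((2 : ℕ) : ℝ) by norm_num, ENNReal.rpow_natCast]
    have e3 : ∀ x, ‖w x‖ₑ ^ ((3 : ℝ≥0∞).toReal) = ‖w x‖ₑ ^ (2 : ℕ) * ‖w x‖ₑ := fun x => by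
      rw [show (3 : ℝ≥0∞).toReal = ((3 : ℕ) : ℝ) by norm_num, ENNReal.rpow_natCast, pow_succ]
    simp_rw [e2] at h2'
    simp_rw [e3]
    calc ∫⁻ x, ‖w x‖ₑ ^ (2 : ℕ) * ‖w x‖ₑ ≤ ∫⁻ x, ‖w x‖ₑ ^ (2 : ℕ) * ENNReal.ofReal K :=
          lintegral_mono fun x => mul_le_mul' le_rfl (by
            rw [← ofReal_norm]; exact ENNReal.ofReal_le_ofReal (hK x))
      _ = (∫⁻ x, ‖w x‖ₑ ^ (2 : ℕ)) * ENNReal.ofReal K := lintegral_mul_const' _ _ ENNReal.ofReal_ne_top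
      _ < ⊤ := ENNReal.mul_lt_top h2' ENNReal.ofReal_lt_top
  have h := h3.norm_rpow_div 2
  have e : (fun x => ‖w x‖ ^ (2 : ℝ≥0∞).toReal) = fun x => ‖w x‖ ^ 2 := by
    funext x
    rw [show (2 : ℝ≥0∞).toReal = ((2 : ℕ) : ℝ) by norm_num, Real.rpow_natCast]
  rw [e, show (3 : ℝ≥0∞) / 2 = 3 / 2 from rfl] at h
  exact h

/-- **Orthogonality**: `∫ ⟪v, ∇θ⟫ = 0` for a `C¹` divergence-free field `v` and `θ ∈ C¹_c`.
[cite: Leray1934, §6 (1.11) p. 203] -/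
theorem integral_inner_gradient_eq_zero_of_isDivFree
    {v : EuclideanSpace ℝ (Fin 3) → EuclideanSpace ℝ (Fin 3)} {θ : EuclideanSpace ℝ (Fin 3) → ℝ}
    (hv : ContDiff ℝ 1 v) (hdiv : VectorCalculus.IsDivFree v) (hθ : ContDiff ℝ 1 θ)
    (hc : HasCompactSupport θ) : ∫ x, ⟪v x, gradient θ x⟫ = 0 := by
  have h := integral_mul_divergence_add_eq_zero_left hθ hv hc
  have hz : ∫ x, θ x * VectorCalculus.divergence v x = 0 := by
    refine integral_eq_zero_of_ae (Eventually.of_forall fun x => ?_)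
    simp [hdiv x]
  linarith

/-- **Continuity of ball energies of a classical velocity field**: if `u` is jointly continuous on
`[a, b] × ℝ³`, then `t ↦ ∫_{B̄(y,1)} |u(t)|²` is continuous on `[a, b]`. [folklore] -/
theorem continuousOn_ballEnergy {u : ℝ → EuclideanSpace ℝ (Fin 3) → EuclideanSpace ℝ (Fin 3)}
    {a b : ℝ} (hab : a ≤ b) (hu : ContinuousOn (uncurry u) (Icc a b ×ˢ univ))
    (y : EuclideanSpace ℝ (Fin 3)) :
    ContinuousOn (fun t => ∫ x in closedBall y 1, ‖u t x‖ ^ 2) (Icc a b) := by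
  set v : ℝ → EuclideanSpace ℝ (Fin 3) → ℝ := fun t x => ‖u (Set.projIcc a b hab t) x‖ ^ 2 with hv
  have hvc : Continuous (uncurry v) := by
    have h1 : Continuous fun q : ℝ × EuclideanSpace ℝ (Fin 3) =>
        ((Set.projIcc a b hab q.1 : ℝ), q.2) :=
      (continuous_subtype_val.comp (continuous_projIcc.comp continuous_fst)).prodMk continuous_snd
    have h2 : Continuous fun q : ℝ × EuclideanSpace ℝ (Fin 3) => uncurry u ((Set.projIcc a b hab q.1 : ℝ), q.2) :=
      hu.comp_continuous h1 fun q => ⟨(Set.projIcc a b hab q.1).2, mem_univ _⟩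
    exact (h2.norm).pow 2
  have hcont : Continuous fun t => ∫ x in closedBall y 1, v t x :=
    continuous_parametric_integral_of_continuous hvc (isCompact_closedBall y 1)
  refine hcont.continuousOn.congr fun t ht => ?_
  simp only [hv, Set.projIcc_of_mem hab ht]

end Summit.NavierStokesRegularity.NavierStokesRegularity.Theorems.StrainDoors

end
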